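/-
Copyright (c) 2026 the pub-hodgecm-mathlib formalisation cell (harness21).  Prover seat hodgecm-mathlib-K2E3-p14 (g4), HCML Track B «K2-LIT» (build stream 29),
h413 = `stmt-HodgeConjecture-24833`, line `K2_E3_EllipticInputs`, unit U12 «Characters», §L line (lead K2E3-p12 (g4)), deal (LBU-01) «(L-B_U)′ AT `N ≤ 1` BY POINT
SUPPORT», FILE (F2): THE (L-B_U)′ SOCKET VERBATIM AT `N := 0` AND `N := 1`.  2026-09-04.
-/
import Summits.HodgeConjecture.HodgeConjecture.Theorems.K2E3LieUnitaryNilpotentFourierRegularOfPointSupport   -- ★ (F1) p857403 (this seat): `nilpotentFourierRegular_of_cone_eq_zero`; brings ★ p856833, ★ FILE A∕B∕C of the `𝔲₂` road, ★ `piFourierSB_mem_schwartzBruhat`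
import HarnessLib

/-!
# K2 ∕ E3, §L deal (LBU-01), FILE (F2) — (L-B_U)′ «Harish-Chandra's Thm. 4.4 ∕ §21 for `J(𝒩)` on `𝔲(σ_w, H_w)`» VERBATIM IN RANKS `N = 0` AND `N = 1`

Cell `pub/hodgecm-mathlib` (D-0151), Track B «K2-LIT», crux H413 = `stmt-HodgeConjecture-24833` (lane `--supports … --as helper`, count-neutral); seat K2E3-p14 (g4);
§L line lead K2E3-p12 (g4), deal (LBU-01) 2026-09-04T04:40:11Z.  THEOREMS ONLY (no definition ∕ instance ∕ notation ∕ named fact ∕ `sorry`); never imports `Cruxes/…/Lines`.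
The hosted socket (L-B_U)′ `sig_K2E3UNilpotentFourierRegular` (U12 ED. 11 :791, statement for every `N`) is discharged here at `N := 0` and `N := 1` by (F1)
`nilpotentFourierRegular_of_cone_eq_zero`: in both ranks the nilpotent cone of `𝔲_N(H_w)` is `{0}` (`M₀ = 0`; a nilpotent `1 × 1` matrix over a field is `0`,
★ `eq_zero_of_isNilpotent_fin_one`), and `𝓕` preserves `C_c^∞(𝔲_N)` (`N = 0`: `↥𝔲₀` is a single point; `N = 1`: `𝔲₁ = λ·ι(L⁺_v)` is a line over the fixed field —
★ `exists_quadraticCoordinates`, `eq_lam_mul_of_skew` — and along the chart `X ↦ im X₀₀` the transform is the one-variable Fourier transform of `L⁺_v` at the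
character `ψ ∘ ι ∘ (δ²·)`, ★ `piFourierSB_mem_schwartzBruhat` on `(L⁺_v)^{Fin 1}`, exactly as ★ p856833 §1 does on `(L⁺_v)⁴`).
* §1 `u0_nilpotentFourierRegular` — :791 at `N := 0`;
* §2 `exists_addEquiv_trace_eq_one` — the trace chart of `𝔲₁(H_w)`: `e : ↥𝔲₁ ≃+ (Fin 1 → L⁺_v)` bicontinuous with `tr(X·Y) = ι(δ² · eX · eY)`;
* §3 `isLocSmooth_lieFourier_one` — `𝓕` maps `C_c^∞(𝔲₁)` to itself;
* §4 **`u1_nilpotentFourierRegular`** — :791 at `N := 1`.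
[HarishChandra1999AdmissibleDistributions, Thm. 3.9, Thm. 4.4 p. 11, §21 p. 87] [WeilBNT1967, Ch. VII §2 Prop. 2] [PlatonovRapinchuk1994, §2.3].
HONEST LABEL: HC_CM is proved only modulo the 7 printed citations (2 remaining named inputs: hLiu418 = `stmt-HodgeConjecture-24832`, h413 = `stmt-HodgeConjecture-24833`)
until rung 0 closes; count-neutral: (L-B_U)′ :791 quantifies EVERY `N`; ranks `N ≥ 2` (non-zero nilpotent orbits; `N = 2` = ★ p856833 ∕ p857300 by place type) are NOT
proved here, and the socket stays OPEN until the dealer re-ties it by rank.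

## References
* [HarishChandra1999AdmissibleDistributions] Harish-Chandra (DeBacker–Sally), *Admissible Invariant Distributions on Reductive p-adic Groups* (1999), Thm. 3.9, Thm. 4.4, §21.
* [WeilBNT1967] A. Weil, *Basic Number Theory* (1967), Ch. VII §2, Prop. 2 (Fourier transform of Schwartz–Bruhat functions).
* [PlatonovRapinchuk1994] V. Platonov, A. Rapinchuk, *Algebraic Groups and Number Theory* (1994), §2.3.
-/

set_option autoImplicit false
set_option linter.dupNamespace false   -- `Summit.HodgeConjecture.HodgeConjecture.…` (D-0017 nested layout; lakefile exemption for Summits)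

noncomputable section

open MeasureTheory Filter Topology NumberField IsDedekindDomain
open scoped Matrix MatrixGroups NNReal
open Literature.NumberTheory.Rogawski1990 Literature.NumberTheory.Automorphic Literature.NumberTheory.Automorphic.UnitaryGroup Literature.NumberTheory.Automorphic.LocalFieldHaar
open Literature.NumberTheory.GaloisRepresentations Literature.NumberTheory.GaloisRepresentations.IsNonarchimedeanLocalField
open Summit.HodgeConjecture.HodgeConjecture.Cruxes.H413.K2E3LieUnitary
open Summit.HodgeConjecture.HodgeConjecture.Cruxes.H413.K2E3GLnNilpotentFourierPointSupport (eq_zero_of_isNilpotent_fin_one)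
open Summit.HodgeConjecture.HodgeConjecture.Cruxes.H413.K2E3LieUnitaryNilpotentFourierRegularOfPointSupport (nilpotentFourierRegular_of_cone_eq_zero)
open Summit.HodgeConjecture.HodgeConjecture.Cruxes.H413.K2E3U2DiscrInvFourthRootLocallyIntegrable (exists_quadraticCoordinates)
open Summit.HodgeConjecture.HodgeConjecture.Cruxes.H413.K2E3U2LieDiagonalCoordinates (ρ_add eq_lam_mul_of_skew)

namespace Summit.HodgeConjecture.HodgeConjecture.Cruxes.H413.K2E3U01NilpotentFourierRegular

section CM

variable (L : Type) [Field L] [NumberField L] [IsCMField L] (v : HeightOneSpectrum (𝓞 ↥(maximalRealSubfield L)))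
  (w : UnitaryGroup.PlacesOver L v) (hw : IsCMField.complexConj L • w.1 = w.1)

/-! ## §2 The trace chart of `𝔲₁(H_w)` -/

include hw in
/-- **The trace chart of `𝔲₁(H_w)`.**  At a non-split `w`, `𝔲₁(H_w) = {x ∈ L_w | σ_w x = −x} = λ·ι(L⁺_v)` (`λ = δ`, `λ² = ι(δ²)`, ★ `exists_quadraticCoordinates`,
`eq_lam_mul_of_skew`); the map `e : X ↦ im X₀₀` is an additive bicontinuous bijection `↥𝔲₁ ≃ (Fin 1 → L⁺_v)` with `tr(X·Y) = ι(δ² · eX₀ · eY₀)`.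
[cite: PlatonovRapinchuk1994, §2.3] [cite: HarishChandra1999AdmissibleDistributions, §4 p. 11] -/
theorem exists_addEquiv_trace_eq_one (H : Matrix (Fin 1) (Fin 1) L) (hdet : H.det ≠ 0) :
    ∃ (e : ↥(lieOfForm (galAdicCompletionMap (L := L) (IsCMField.complexConj L) hw) (UnitaryGroup.placeForm H w.1)) ≃+ (Fin 1 → v.adicCompletion ↥(maximalRealSubfield L)))
      (β : Fin 1 → v.adicCompletion ↥(maximalRealSubfield L)), Continuous e ∧ Continuous e.symm ∧ (∀ i, β i ≠ 0) ∧
      ∀ X Y : ↥(lieOfForm (galAdicCompletionMap (L := L) (IsCMField.complexConj L) hw) (UnitaryGroup.placeForm H w.1)),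
        Matrix.trace (X.1 * Y.1) = toPlace v w (∑ i : Fin 1, β i * (e X) i * (e Y) i) := by
  classical
  haveI : Algebra.IsQuadraticExtension ↥(maximalRealSubfield L) L := IsCMField.isQuadraticExtension L
  have hc1 := IsCMField.complexConj_ne_one L
  have hσι : ∀ r, galAdicCompletionMap (L := L) (IsCMField.complexConj L) hw (toPlace v w r) = toPlace v w r := fun r =>
    (galAdicCompletionMap_eq_self_iff_mem_range (IsCMField.complexConj L) hc1 v w hw _).2 ⟨r, rfl⟩
  have h2 : (2 : w.1.adicCompletion L) ≠ 0 := two_ne_zero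
  obtain ⟨lam, d, ρ, hσl, hlam2, hd0, hρc, hρ1, hρ2⟩ := exists_quadraticCoordinates L v w hw
  have hh : algebraMap L (w.1.adicCompletion L) (H 0 0) ≠ 0 := by
    rw [Matrix.det_fin_one] at hdet
    exact (map_ne_zero _).2 hdet
  have hHw : ∀ i j : Fin 1, UnitaryGroup.placeForm H w.1 i j = algebraMap L (w.1.adicCompletion L) (H 0 0) := by
    intro i j
    rw [Subsingleton.elim i 0, Subsingleton.elim j 0]
    rfl
  -- membership: skew entry
  have hskew : ∀ X : ↥(lieOfForm (galAdicCompletionMap (L := L) (IsCMField.complexConj L) hw) (UnitaryGroup.placeForm H w.1)),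
      galAdicCompletionMap (L := L) (IsCMField.complexConj L) hw (X.1 0 0) = -X.1 0 0 := by
    intro X
    have h := X.2
    rw [mem_lieOfForm_iff] at h
    have h00 := congrFun (congrFun h 0) 0
    rw [Matrix.add_apply, Matrix.mul_apply, Matrix.mul_apply, Fin.sum_univ_one, Fin.sum_univ_one, Matrix.transpose_apply, Matrix.map_apply, Matrix.zero_apply,
      hHw] at h00
    -- `σ(x) h + h x = 0`
    have : (galAdicCompletionMap (L := L) (IsCMField.complexConj L) hw (X.1 0 0) + X.1 0 0) * algebraMap L (w.1.adicCompletion L) (H 0 0) = 0 := by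
      linear_combination h00
    exact eq_neg_of_add_eq_zero_left ((mul_eq_zero.1 this).resolve_right hh)
  have hmem : ∀ t : v.adicCompletion ↥(maximalRealSubfield L),
      (Matrix.of (fun _ _ => lam * toPlace v w t) : Matrix (Fin 1) (Fin 1) (w.1.adicCompletion L)) ∈
        lieOfForm (galAdicCompletionMap (L := L) (IsCMField.complexConj L) hw) (UnitaryGroup.placeForm H w.1) := by
    intro t
    rw [mem_lieOfForm_iff]
    refine Matrix.ext fun i j => ?_
    rw [Matrix.add_apply, Matrix.mul_apply, Matrix.mul_apply, Fin.sum_univ_one, Fin.sum_univ_one, Matrix.transpose_apply, Matrix.map_apply, Matrix.zero_apply,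
      hHw, hHw, Matrix.of_apply, Matrix.of_apply, map_mul, hσl, hσι]
    ring
  -- the chart
  let e : ↥(lieOfForm (galAdicCompletionMap (L := L) (IsCMField.complexConj L) hw) (UnitaryGroup.placeForm H w.1)) ≃+ (Fin 1 → v.adicCompletion ↥(maximalRealSubfield L)) :=
    { toFun := fun X _ => (ρ (X.1 0 0)).2
      invFun := fun t => ⟨Matrix.of (fun _ _ => lam * toPlace v w (t 0)), hmem (t 0)⟩
      left_inv := fun X => by
        apply Subtype.ext
        refine Matrix.ext fun i j => ?_
        rw [Subsingleton.elim i 0, Subsingleton.elim j 0]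
        show lam * toPlace v w (ρ (X.1 0 0)).2 = X.1 0 0
        exact (eq_lam_mul_of_skew (galAdicCompletionMap (L := L) (IsCMField.complexConj L) hw) (toPlace v w) lam ρ hρ1 hσι hσl h2 (hskew X)).symm
      right_inv := fun t => by
        funext i
        rw [Subsingleton.elim i 0]
        show (ρ (lam * toPlace v w (t 0))).2 = t 0
        have h := hρ2 0 (t 0)
        rw [map_zero, zero_add] at h
        rw [h]
      map_add' := fun X Y => by
        funext i
        show (ρ ((X.1 + Y.1) 0 0)).2 = (ρ (X.1 0 0)).2 + (ρ (Y.1 0 0)).2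
        rw [Matrix.add_apply, ρ_add (toPlace v w) lam ρ hρ1 hρ2]
        rfl }
  have he : Continuous e :=
    continuous_pi fun _ => (continuous_snd.comp hρc).comp ((continuous_subtype_val.matrix_elem 0 0))
  have hes : Continuous e.symm := by
    refine continuous_induced_rng.2 ?_
    show Continuous fun t : Fin 1 → v.adicCompletion ↥(maximalRealSubfield L) => (Matrix.of (fun _ _ => lam * toPlace v w (t 0)) : Matrix (Fin 1) (Fin 1) (w.1.adicCompletion L))
    exact continuous_matrix fun _ _ => continuous_const.mul ((continuous_toPlace v w).comp (continuous_apply 0))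
  refine ⟨e, fun _ => d, he, hes, fun _ => hd0, fun X Y => ?_⟩
  -- `tr(X·Y) = x y = λ² ι(s) ι(t) = ι(d s t)`
  have hX := eq_lam_mul_of_skew (galAdicCompletionMap (L := L) (IsCMField.complexConj L) hw) (toPlace v w) lam ρ hρ1 hσι hσl h2 (hskew X)
  have hY := eq_lam_mul_of_skew (galAdicCompletionMap (L := L) (IsCMField.complexConj L) hw) (toPlace v w) lam ρ hρ1 hσι hσl h2 (hskew Y)
  rw [Matrix.trace_fin_one, Matrix.mul_apply, Fin.sum_univ_one, Fin.sum_univ_one, hX, hY]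
  show lam * toPlace v w (ρ (X.1 0 0)).2 * (lam * toPlace v w (ρ (Y.1 0 0)).2) = toPlace v w (d * (ρ (X.1 0 0)).2 * (ρ (Y.1 0 0)).2)
  rw [map_mul, map_mul, ← hlam2]
  ring

/-! ## §3 `𝓕` preserves `C_c^∞(𝔲₁)` -/

set_option maxHeartbeats 1600000 in
include hw in
/-- **The Fourier transform maps `C_c^∞(𝔲₁(H_w))` to itself** (`w` non-split, `det H ≠ 0`, `μ𝔤` left-invariant Borel, `ψ` continuous and non-trivial on `ι(L⁺_v)`):
transport of ★ `piFourierSB_mem_schwartzBruhat` on `(L⁺_v)^{Fin 1}` along the trace chart of §2 — `tr(Y·X) = ι(⟨eX, β·eY⟩)` — exactly as ★ p856833 §1 at `N = 2`.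
[cite: WeilBNT1967, Ch. VII §2, Prop. 2] [cite: HarishChandra1999AdmissibleDistributions, §4 p. 11] -/
theorem isLocSmooth_lieFourier_one (H : Matrix (Fin 1) (Fin 1) L) (hdet : H.det ≠ 0)
    (ψ : AddChar (w.1.adicCompletion L) Circle) (hψ : ψ.IsContinuousNontrivial)
    (hψι : ∃ a : w.1.adicCompletion L, galAdicCompletionMap (L := L) (IsCMField.complexConj L) hw a = a ∧ ψ a ≠ 1)
    [MeasurableSpace ↥(lieOfForm (galAdicCompletionMap (L := L) (IsCMField.complexConj L) hw) (UnitaryGroup.placeForm H w.1))]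
    [BorelSpace ↥(lieOfForm (galAdicCompletionMap (L := L) (IsCMField.complexConj L) hw) (UnitaryGroup.placeForm H w.1))]
    (μ𝔤 : Measure ↥(lieOfForm (galAdicCompletionMap (L := L) (IsCMField.complexConj L) hw) (UnitaryGroup.placeForm H w.1))) [μ𝔤.IsAddLeftInvariant]
    {f : ↥(lieOfForm (galAdicCompletionMap (L := L) (IsCMField.complexConj L) hw) (UnitaryGroup.placeForm H w.1)) → ℂ} (hf : IsLocSmooth f) :
    IsLocSmooth (lieFourier (galAdicCompletionMap (L := L) (IsCMField.complexConj L) hw) (UnitaryGroup.placeForm H w.1)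
      (fun x : w.1.adicCompletion L => ((ψ x : Circle) : ℂ)) μ𝔤 f) := by
  classical
  haveI : Algebra.IsQuadraticExtension ↥(maximalRealSubfield L) L := IsCMField.isQuadraticExtension L
  have hc1 := IsCMField.complexConj_ne_one L
  -- the character `ψ ∘ ι` of `L⁺_v`
  set ψF : AddChar (v.adicCompletion ↥(maximalRealSubfield L)) Circle := ψ.compAddMonoidHom (toPlace v w).toAddMonoidHom with hψF
  have hψFa : ∀ t, ψF t = ψ (toPlace v w t) := fun t => rfl
  have hψF' : ψF.IsContinuousNontrivial := by
    refine ⟨?_, fun h0 => ?_⟩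
    · show Continuous fun t => ψF t
      simp only [hψFa]
      exact hψ.1.comp (continuous_toPlace v w)
    · obtain ⟨a, ha, hne⟩ := hψι
      obtain ⟨t, rfl⟩ := (galAdicCompletionMap_eq_self_iff_mem_range (IsCMField.complexConj L) hc1 v w hw a).1 ha
      exact hne (by rw [← toPlace_eq_algebraMap_adicCompletion, ← hψFa, h0, AddChar.zero_apply])
  -- the trace chart and the scaling by `β`
  obtain ⟨e, β, he, hes, hβ0, htr⟩ := exists_addEquiv_trace_eq_one L v w hw H hdet
  let eH : ↥(lieOfForm (galAdicCompletionMap (L := L) (IsCMField.complexConj L) hw) (UnitaryGroup.placeForm H w.1)) ≃ₜ (Fin 1 → v.adicCompletion ↥(maximalRealSubfield L)) :=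
    Homeomorph.mk e.toEquiv he hes
  let A : (Fin 1 → v.adicCompletion ↥(maximalRealSubfield L)) ≃ₜ (Fin 1 → v.adicCompletion ↥(maximalRealSubfield L)) :=
    { toFun := fun y i => β i * y i
      invFun := fun y i => (β i)⁻¹ * y i
      left_inv := fun y => funext fun i => by simp [hβ0 i]
      right_inv := fun y => funext fun i => by simp [hβ0 i]
      continuous_toFun := continuous_pi fun i => continuous_const.mul (continuous_apply i)
      continuous_invFun := continuous_pi fun i => continuous_const.mul (continuous_apply i) }
  -- the transported measurable structure on `(L⁺_v)^1` is Borel, the transported measure is left-invariant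
  letI mPi : MeasurableSpace (Fin 1 → v.adicCompletion ↥(maximalRealSubfield L)) :=
    MeasurableSpace.comap eH.symm ‹MeasurableSpace ↥(lieOfForm (galAdicCompletionMap (L := L) (IsCMField.complexConj L) hw) (UnitaryGroup.placeForm H w.1))›
  let em : ↥(lieOfForm (galAdicCompletionMap (L := L) (IsCMField.complexConj L) hw) (UnitaryGroup.placeForm H w.1)) ≃ᵐ (Fin 1 → v.adicCompletion ↥(maximalRealSubfield L)) :=
    { toEquiv := eH.toEquiv
      measurable_toFun := by
        refine measurable_iff_comap_le.2 (le_of_eq ?_)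
        rw [MeasurableSpace.comap_comp]
        convert MeasurableSpace.comap_id using 2
        funext X
        exact eH.symm_apply_apply X
      measurable_invFun := measurable_iff_comap_le.2 le_rfl }
  haveI : BorelSpace (Fin 1 → v.adicCompletion ↥(maximalRealSubfield L)) := em.symm.measurableEmbedding.borelSpace eH.symm.isInducing
  set ν : Measure (Fin 1 → v.adicCompletion ↥(maximalRealSubfield L)) := μ𝔤.map em with hν
  haveI : ν.IsAddLeftInvariant := by
    have h := isAddLeftInvariant_map (μ := μ𝔤)
      (⟨e, fun X Y => e.map_add X Y⟩ : AddHom ↥(lieOfForm (galAdicCompletionMap (L := L) (IsCMField.complexConj L) hw) (UnitaryGroup.placeForm H w.1))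
        (Fin 1 → v.adicCompletion ↥(maximalRealSubfield L))) em.measurable e.surjective
    exact h
  -- `𝓕f = (f ∘ e⁻¹)^ ∘ (β · e)`
  have hΦ : (f ∘ em.symm) ∈ SchwartzBruhat (Fin 1 → v.adicCompletion ↥(maximalRealSubfield L)) :=
    (mem_schwartzBruhat_iff).2 ⟨hf.1.comp_continuous eH.symm.continuous, hf.2.comp_homeomorph eH.symm⟩
  have hkey : lieFourier (galAdicCompletionMap (L := L) (IsCMField.complexConj L) hw) (UnitaryGroup.placeForm H w.1)
      (fun x : w.1.adicCompletion L => ((ψ x : Circle) : ℂ)) μ𝔤 f = (piFourierSB ψF ν (f ∘ em.symm)) ∘ (eH.trans A) := by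
    funext Y
    rw [lieFourier_apply]
    simp only [Function.comp_apply, piFourierSB_apply, hν]
    rw [integral_map_equiv]
    refine integral_congr_ae (Eventually.of_forall fun X => ?_)
    simp only [MeasurableEquiv.symm_apply_apply, hψFa]
    have h1 : toPlace v w ((em X) ⬝ᵥ (eH.trans A) Y) = Matrix.trace (Y.1 * X.1) := by
      rw [htr Y X]
      congr 1
      show ∑ i, e X i * (β i * e Y i) = ∑ i, β i * e Y i * e X i
      exact Finset.sum_congr rfl fun i _ => by ring
    rw [h1]
  rw [hkey]
  have hsb := piFourierSB_mem_schwartzBruhat ν hψF' hΦ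
  rw [mem_schwartzBruhat_iff] at hsb
  exact ⟨hsb.1.comp_continuous (eH.trans A).continuous, hsb.2.comp_homeomorph (eH.trans A)⟩

end CM

/-! ## §1 (L-B_U)′ verbatim at `N = 0` -/

section Zero

set_option maxHeartbeats 1600000 in
/-- **(L-B_U)′ «Thm. 4.4 ∕ §21 for `J(𝒩)` on `𝔲(σ_w, H_w)`» AT `N = 0`** — the hosted socket `sig_K2E3UNilpotentFourierRegular` (U12 ED. 11 :791) with `N := 0`, VERBATIM: `M₀(L_w) = 0`,
so `𝔲₀` is a point, its nilpotent cone is `{0}`, every function on it is in `C_c^∞`, and (F1) applies. [cite: HarishChandra1999AdmissibleDistributions, Thm. 4.4 p. 11, §21 p. 87] -/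
theorem u0_nilpotentFourierRegular :
    ∀ (L : Type) [Field L] [NumberField L] [IsCMField L] (H : Matrix (Fin 0) (Fin 0) L),
      (H.map (cmConjRingHom L))ᵀ = H → H.det ≠ 0 →
      ∀ (v : HeightOneSpectrum (𝓞 ↥(maximalRealSubfield L))) (w : UnitaryGroup.PlacesOver L v) (hw : IsCMField.complexConj L • w.1 = w.1)
      (ψ : AddChar (w.1.adicCompletion L) Circle), ψ.IsContinuousNontrivial →
      (∃ a : w.1.adicCompletion L, galAdicCompletionMap (L := L) (IsCMField.complexConj L) hw a = a ∧ ψ a ≠ 1) →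
      ∀ [MeasurableSpace ↥(lieOfForm (galAdicCompletionMap (L := L) (IsCMField.complexConj L) hw) (UnitaryGroup.placeForm H w.1))]
        [BorelSpace ↥(lieOfForm (galAdicCompletionMap (L := L) (IsCMField.complexConj L) hw) (UnitaryGroup.placeForm H w.1))]
        (μ𝔤 : Measure ↥(lieOfForm (galAdicCompletionMap (L := L) (IsCMField.complexConj L) hw) (UnitaryGroup.placeForm H w.1))) [μ𝔤.IsAddHaarMeasure],
      ∀ T : (↥(lieOfForm (galAdicCompletionMap (L := L) (IsCMField.complexConj L) hw) (UnitaryGroup.placeForm H w.1)) → ℂ) → ℂ,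
        ((∀ f₁ f₂ : ↥(lieOfForm (galAdicCompletionMap (L := L) (IsCMField.complexConj L) hw) (UnitaryGroup.placeForm H w.1)) → ℂ, IsLocSmooth f₁ → IsLocSmooth f₂ → T (f₁ + f₂) = T f₁ + T f₂) ∧
         (∀ (a : ℂ) (f : ↥(lieOfForm (galAdicCompletionMap (L := L) (IsCMField.complexConj L) hw) (UnitaryGroup.placeForm H w.1)) → ℂ), IsLocSmooth f → T (a • f) = a * T f) ∧
         (∀ (x : ↥(unitaryGroupOfForm (galAdicCompletionMap (L := L) (IsCMField.complexConj L) hw) (UnitaryGroup.placeForm H w.1))) (f : ↥(lieOfForm (galAdicCompletionMap (L := L) (IsCMField.complexConj L) hw) (UnitaryGroup.placeForm H w.1)) → ℂ), IsLocSmooth f →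
            T (fun X => f ⟨((x : GL (Fin 0) (w.1.adicCompletion L)) : Matrix (Fin 0) (Fin 0) (w.1.adicCompletion L)) * X.1 * (((x : GL (Fin 0) (w.1.adicCompletion L))⁻¹ : GL (Fin 0) (w.1.adicCompletion L)) : Matrix (Fin 0) (Fin 0) (w.1.adicCompletion L)),
              conj_mem_lieOfForm x.2 X.2⟩) = T f) ∧
         (∀ f : ↥(lieOfForm (galAdicCompletionMap (L := L) (IsCMField.complexConj L) hw) (UnitaryGroup.placeForm H w.1)) → ℂ, IsLocSmooth f → (∀ X ∈ tsupport f, ¬ IsNilpotent X.1) → T f = 0)) →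
        ∃ Fn : ↥(lieOfForm (galAdicCompletionMap (L := L) (IsCMField.complexConj L) hw) (UnitaryGroup.placeForm H w.1)) → ℂ, LocallyIntegrable Fn μ𝔤 ∧
          (∀ f : ↥(lieOfForm (galAdicCompletionMap (L := L) (IsCMField.complexConj L) hw) (UnitaryGroup.placeForm H w.1)) → ℂ, IsLocSmooth f → T (lieFourier (galAdicCompletionMap (L := L) (IsCMField.complexConj L) hw) (UnitaryGroup.placeForm H w.1) (fun x : w.1.adicCompletion L => ((ψ x : Circle) : ℂ)) μ𝔤 f) = ∫ X, f X * Fn X ∂μ𝔤) ∧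
          (∀ X : ↥(lieOfForm (galAdicCompletionMap (L := L) (IsCMField.complexConj L) hw) (UnitaryGroup.placeForm H w.1)), IsUnit X.1.charpoly.discr → ∀ᶠ Y in 𝓝 X, Fn Y = Fn X) ∧
          (∀ C : Set ↥(lieOfForm (galAdicCompletionMap (L := L) (IsCMField.complexConj L) hw) (UnitaryGroup.placeForm H w.1)), IsCompact C → ∃ B : ℝ, ∀ X ∈ C,
              ((NNReal.sqrt (NNReal.sqrt (normAbs (w.1.adicCompletion L) X.1.charpoly.discr)) : ℝ≥0) : ℝ) * ‖Fn X‖ ≤ B) := by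
  intro L _ _ _ H hH hdet v w hw ψ hψ hψι _ _ μ𝔤 _ T hT
  haveI : Subsingleton ↥(lieOfForm (galAdicCompletionMap (L := L) (IsCMField.complexConj L) hw) (UnitaryGroup.placeForm H w.1)) :=
    ⟨fun X Y => Subtype.ext (Subsingleton.elim _ _)⟩
  refine nilpotentFourierRegular_of_cone_eq_zero L 0 v w hw H ψ μ𝔤 (fun X _ => Subsingleton.elim _ _) (fun f _ => ?_) T hT
  refine ⟨?_, ?_⟩
  · have hconst : lieFourier (galAdicCompletionMap (L := L) (IsCMField.complexConj L) hw) (UnitaryGroup.placeForm H w.1)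
        (fun x : w.1.adicCompletion L => ((ψ x : Circle) : ℂ)) μ𝔤 f =
        fun _ => lieFourier (galAdicCompletionMap (L := L) (IsCMField.complexConj L) hw) (UnitaryGroup.placeForm H w.1)
          (fun x : w.1.adicCompletion L => ((ψ x : Circle) : ℂ)) μ𝔤 f 0 := funext fun X => by rw [Subsingleton.elim X 0]
    rw [hconst]
    exact IsLocallyConstant.const _
  · exact IsCompact.of_isClosed_subset isCompact_univ (isClosed_tsupport _) (Set.subset_univ _)

end Zero

/-! ## §4 (L-B_U)′ verbatim at `N = 1` -/

section One

set_option maxHeartbeats 1600000 in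
/-- **(L-B_U)′ «Thm. 4.4 ∕ §21 for `J(𝒩)` on `𝔲(σ_w, H_w)`» AT `N = 1`** — the hosted socket `sig_K2E3UNilpotentFourierRegular` (U12 ED. 11 :791) with `N := 1`, VERBATIM: a nilpotent
`1 × 1` matrix is `0` (★ `eq_zero_of_isNilpotent_fin_one`), so `J(𝒩) = ℂ·δ₀` by (F1), the smoothness of `𝓕` on the line `𝔲₁ = λ·ι(L⁺_v)` being §3.
[cite: HarishChandra1999AdmissibleDistributions, Thm. 4.4 p. 11, §21 p. 87] [cite: WeilBNT1967, Ch. VII §2, Prop. 2] -/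
theorem u1_nilpotentFourierRegular :
    ∀ (L : Type) [Field L] [NumberField L] [IsCMField L] (H : Matrix (Fin 1) (Fin 1) L),
      (H.map (cmConjRingHom L))ᵀ = H → H.det ≠ 0 →
      ∀ (v : HeightOneSpectrum (𝓞 ↥(maximalRealSubfield L))) (w : UnitaryGroup.PlacesOver L v) (hw : IsCMField.complexConj L • w.1 = w.1)
      (ψ : AddChar (w.1.adicCompletion L) Circle), ψ.IsContinuousNontrivial →
      (∃ a : w.1.adicCompletion L, galAdicCompletionMap (L := L) (IsCMField.complexConj L) hw a = a ∧ ψ a ≠ 1) →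
      ∀ [MeasurableSpace ↥(lieOfForm (galAdicCompletionMap (L := L) (IsCMField.complexConj L) hw) (UnitaryGroup.placeForm H w.1))]
        [BorelSpace ↥(lieOfForm (galAdicCompletionMap (L := L) (IsCMField.complexConj L) hw) (UnitaryGroup.placeForm H w.1))]
        (μ𝔤 : Measure ↥(lieOfForm (galAdicCompletionMap (L := L) (IsCMField.complexConj L) hw) (UnitaryGroup.placeForm H w.1))) [μ𝔤.IsAddHaarMeasure],
      ∀ T : (↥(lieOfForm (galAdicCompletionMap (L := L) (IsCMField.complexConj L) hw) (UnitaryGroup.placeForm H w.1)) → ℂ) → ℂ,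
        ((∀ f₁ f₂ : ↥(lieOfForm (galAdicCompletionMap (L := L) (IsCMField.complexConj L) hw) (UnitaryGroup.placeForm H w.1)) → ℂ, IsLocSmooth f₁ → IsLocSmooth f₂ → T (f₁ + f₂) = T f₁ + T f₂) ∧
         (∀ (a : ℂ) (f : ↥(lieOfForm (galAdicCompletionMap (L := L) (IsCMField.complexConj L) hw) (UnitaryGroup.placeForm H w.1)) → ℂ), IsLocSmooth f → T (a • f) = a * T f) ∧
         (∀ (x : ↥(unitaryGroupOfForm (galAdicCompletionMap (L := L) (IsCMField.complexConj L) hw) (UnitaryGroup.placeForm H w.1))) (f : ↥(lieOfForm (galAdicCompletionMap (L := L) (IsCMField.complexConj L) hw) (UnitaryGroup.placeForm H w.1)) → ℂ), IsLocSmooth f →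
            T (fun X => f ⟨((x : GL (Fin 1) (w.1.adicCompletion L)) : Matrix (Fin 1) (Fin 1) (w.1.adicCompletion L)) * X.1 * (((x : GL (Fin 1) (w.1.adicCompletion L))⁻¹ : GL (Fin 1) (w.1.adicCompletion L)) : Matrix (Fin 1) (Fin 1) (w.1.adicCompletion L)),
              conj_mem_lieOfForm x.2 X.2⟩) = T f) ∧
         (∀ f : ↥(lieOfForm (galAdicCompletionMap (L := L) (IsCMField.complexConj L) hw) (UnitaryGroup.placeForm H w.1)) → ℂ, IsLocSmooth f → (∀ X ∈ tsupport f, ¬ IsNilpotent X.1) → T f = 0)) →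
        ∃ Fn : ↥(lieOfForm (galAdicCompletionMap (L := L) (IsCMField.complexConj L) hw) (UnitaryGroup.placeForm H w.1)) → ℂ, LocallyIntegrable Fn μ𝔤 ∧
          (∀ f : ↥(lieOfForm (galAdicCompletionMap (L := L) (IsCMField.complexConj L) hw) (UnitaryGroup.placeForm H w.1)) → ℂ, IsLocSmooth f → T (lieFourier (galAdicCompletionMap (L := L) (IsCMField.complexConj L) hw) (UnitaryGroup.placeForm H w.1) (fun x : w.1.adicCompletion L => ((ψ x : Circle) : ℂ)) μ𝔤 f) = ∫ X, f X * Fn X ∂μ𝔤) ∧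
          (∀ X : ↥(lieOfForm (galAdicCompletionMap (L := L) (IsCMField.complexConj L) hw) (UnitaryGroup.placeForm H w.1)), IsUnit X.1.charpoly.discr → ∀ᶠ Y in 𝓝 X, Fn Y = Fn X) ∧
          (∀ C : Set ↥(lieOfForm (galAdicCompletionMap (L := L) (IsCMField.complexConj L) hw) (UnitaryGroup.placeForm H w.1)), IsCompact C → ∃ B : ℝ, ∀ X ∈ C,
              ((NNReal.sqrt (NNReal.sqrt (normAbs (w.1.adicCompletion L) X.1.charpoly.discr)) : ℝ≥0) : ℝ) * ‖Fn X‖ ≤ B) := by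
  intro L _ _ _ H hH hdet v w hw ψ hψ hψι _ _ μ𝔤 _ T hT
  exact nilpotentFourierRegular_of_cone_eq_zero L 1 v w hw H ψ μ𝔤 (fun X hX => eq_zero_of_isNilpotent_fin_one hX)
    (fun f hf => isLocSmooth_lieFourier_one L v w hw H hdet ψ hψ hψι μ𝔤 hf) T hT

end One

/-! ## §5 (ED. 2) (L-B_U)′ for `N ≤ 1` in the dealer's leaf shape `sig_K2E3UNilpotentFourierRegularLeOne` (U12 ED. 14 re-cut, `K2/STATUS.md` 04:52:35Z) -/

section LeOne

set_option maxHeartbeats 1600000 in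
/-- **(L-B_U)′ «Thm. 4.4 ∕ §21 for `J(𝒩)` on `𝔲(σ_w, H_w)`» FOR `N ≤ 1`** — the socket text with `(N : ℕ), N ≤ 1 → ∀ (H : …),` in place of `(N : ℕ) (H : …),` (the dealer's leaf
(LBU-01) `sig_K2E3UNilpotentFourierRegularLeOne`, nothing else touched): by cases `N = 0` (§1) ∕ `N = 1` (§4).
[cite: HarishChandra1999AdmissibleDistributions, Thm. 4.4 p. 11, §21 p. 87] -/
theorem uLeOne_nilpotentFourierRegular :
    ∀ (L : Type) [Field L] [NumberField L] [IsCMField L] (N : ℕ), N ≤ 1 → ∀ (H : Matrix (Fin N) (Fin N) L),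
      (H.map (cmConjRingHom L))ᵀ = H → H.det ≠ 0 →
      ∀ (v : HeightOneSpectrum (𝓞 ↥(maximalRealSubfield L))) (w : UnitaryGroup.PlacesOver L v) (hw : IsCMField.complexConj L • w.1 = w.1)
      (ψ : AddChar (w.1.adicCompletion L) Circle), ψ.IsContinuousNontrivial →
      (∃ a : w.1.adicCompletion L, galAdicCompletionMap (L := L) (IsCMField.complexConj L) hw a = a ∧ ψ a ≠ 1) →
      ∀ [MeasurableSpace ↥(lieOfForm (galAdicCompletionMap (L := L) (IsCMField.complexConj L) hw) (UnitaryGroup.placeForm H w.1))]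
        [BorelSpace ↥(lieOfForm (galAdicCompletionMap (L := L) (IsCMField.complexConj L) hw) (UnitaryGroup.placeForm H w.1))]
        (μ𝔤 : Measure ↥(lieOfForm (galAdicCompletionMap (L := L) (IsCMField.complexConj L) hw) (UnitaryGroup.placeForm H w.1))) [μ𝔤.IsAddHaarMeasure],
      ∀ T : (↥(lieOfForm (galAdicCompletionMap (L := L) (IsCMField.complexConj L) hw) (UnitaryGroup.placeForm H w.1)) → ℂ) → ℂ,
        ((∀ f₁ f₂ : ↥(lieOfForm (galAdicCompletionMap (L := L) (IsCMField.complexConj L) hw) (UnitaryGroup.placeForm H w.1)) → ℂ, IsLocSmooth f₁ → IsLocSmooth f₂ → T (f₁ + f₂) = T f₁ + T f₂) ∧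
         (∀ (a : ℂ) (f : ↥(lieOfForm (galAdicCompletionMap (L := L) (IsCMField.complexConj L) hw) (UnitaryGroup.placeForm H w.1)) → ℂ), IsLocSmooth f → T (a • f) = a * T f) ∧
         (∀ (x : ↥(unitaryGroupOfForm (galAdicCompletionMap (L := L) (IsCMField.complexConj L) hw) (UnitaryGroup.placeForm H w.1))) (f : ↥(lieOfForm (galAdicCompletionMap (L := L) (IsCMField.complexConj L) hw) (UnitaryGroup.placeForm H w.1)) → ℂ), IsLocSmooth f →
            T (fun X => f ⟨((x : GL (Fin N) (w.1.adicCompletion L)) : Matrix (Fin N) (Fin N) (w.1.adicCompletion L)) * X.1 * (((x : GL (Fin N) (w.1.adicCompletion L))⁻¹ : GL (Fin N) (w.1.adicCompletion L)) : Matrix (Fin N) (Fin N) (w.1.adicCompletion L)),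
              conj_mem_lieOfForm x.2 X.2⟩) = T f) ∧
         (∀ f : ↥(lieOfForm (galAdicCompletionMap (L := L) (IsCMField.complexConj L) hw) (UnitaryGroup.placeForm H w.1)) → ℂ, IsLocSmooth f → (∀ X ∈ tsupport f, ¬ IsNilpotent X.1) → T f = 0)) →
        ∃ Fn : ↥(lieOfForm (galAdicCompletionMap (L := L) (IsCMField.complexConj L) hw) (UnitaryGroup.placeForm H w.1)) → ℂ, LocallyIntegrable Fn μ𝔤 ∧
          (∀ f : ↥(lieOfForm (galAdicCompletionMap (L := L) (IsCMField.complexConj L) hw) (UnitaryGroup.placeForm H w.1)) → ℂ, IsLocSmooth f → T (lieFourier (galAdicCompletionMap (L := L) (IsCMField.complexConj L) hw) (UnitaryGroup.placeForm H w.1) (fun x : w.1.adicCompletion L => ((ψ x : Circle) : ℂ)) μ𝔤 f) = ∫ X, f X * Fn X ∂μ𝔤) ∧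
          (∀ X : ↥(lieOfForm (galAdicCompletionMap (L := L) (IsCMField.complexConj L) hw) (UnitaryGroup.placeForm H w.1)), IsUnit X.1.charpoly.discr → ∀ᶠ Y in 𝓝 X, Fn Y = Fn X) ∧
          (∀ C : Set ↥(lieOfForm (galAdicCompletionMap (L := L) (IsCMField.complexConj L) hw) (UnitaryGroup.placeForm H w.1)), IsCompact C → ∃ B : ℝ, ∀ X ∈ C,
              ((NNReal.sqrt (NNReal.sqrt (normAbs (w.1.adicCompletion L) X.1.charpoly.discr)) : ℝ≥0) : ℝ) * ‖Fn X‖ ≤ B) := by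
  intro L _ _ _ N hN
  rcases Nat.le_one_iff_eq_zero_or_eq_one.mp hN with rfl | rfl
  · exact u0_nilpotentFourierRegular L
  · exact u1_nilpotentFourierRegular L

end LeOne

end Summit.HodgeConjecture.HodgeConjecture.Cruxes.H413.K2E3U01NilpotentFourierRegular

end
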